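import Literature.NumberTheory.NumberFields.IdelicArtinMapNormCompatibility
import Literature.NumberTheory.NumberFields.IdelicArtinMapOnCongruenceIdeles
import Literature.NumberTheory.NumberFields.RayClassFieldsOfRat
import HarnessLib

/-!
# `[y, K']` on roots of unity is `[N_{K'/K} y, K]`: Tate 4.3 (Cassels–Fröhlich VII) read through the cyclotomic
# character — Shimura's «`σ = [s, K]` on `ℚ_ab`»

Topic `NumberTheory/NumberFields` (global class field theory, idelic dictionary); namespace
`Literature.NumberTheory.NumberFields`.  THEOREMS ONLY (no definition, no named fact, no instance; D-0026 net
debt 0).  Family `hodge`, lane `hodge-director` Track 2f (`flt-inv`), sequel of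
`IdelicArtinMapNormCompatibility.lean` (Tate VII Prop. 4.3: `θ(ψ_{L'|K'}(y)) = ψ_{L|K}(N_{K'/K} y)`, in Shimura's
letters `([y, K']|_{L'})|_L = [N_{K'/K} y, K]|_L`) for CYCLOTOMIC class fields: `L = K(μ_N) ⊆ K̄`,
`L' = K'(μ_N) ⊆ K̄'`.  On these the Galois action is read by the tree's cyclotomic character
`cycloChar K L N : G(L|K) ↪ (ℤ/N)ˣ` (`σ ζ = ζ^{χ_N(σ)}`, `GaloisRepresentations/CyclotomicFrobenius`), which does
not depend on the embedding `L → L'`; so Tate 4.3 becomes an identity of units of `ℤ/N` free of any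
choice: **`χ_N([y, K']|_{K'(μ_N)}) = χ_N([N_{K'/K} y, K]|_{K(μ_N)})`**, i.e. `[y, K']` acts on every `N`-th root
of unity `ζ ∈ K̄'` as `ζ ↦ ζ^c` with the SAME exponent `c ∈ (ℤ/N)ˣ` by which `[N_{K'/K} y, K]` acts on the
`N`-th roots of unity in `K̄`.  With `K = ℚ` (sequel file) this is the sentence of Shimura's theory of complex
multiplication «`[s, K] = σ` on `ℚ_ab`» for `σ = [N_{K/ℚ}(s), ℚ]` (Shimura 1971 §6.8; Tate VII §5.7
«`ζ^{ψ(x)} = ζ^{u⁻¹}`» then gives the exponent).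

## Source

> J. Tate, *Global class field theory*, Ch. VII of Cassels–Fröhlich (1967), §4 Prop. 4.3 (PDF p. 212): the
> commutative square `ψ_{L/K} ∘ N_{K'/K} = θ ∘ ψ_{L'/K'}`; §5.7 (PDF p. 214) «Example. Cyclotomic Fields».
> J. Neukirch, *Algebraic Number Theory* (1999), Ch. VI §5 Prop. (5.2) (p. 388).

## Main statements (`K ⊆ K'` number fields, `N ≥ 1`, `L ⊆ K̄` and `L' ⊆ K̄'` with `IsCyclotomicExtension {N}`)

* §1 `cycloChar_restrictNormalHom_restrictScalars`: for a compatible inclusion `L → L'`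
  (`[Algebra L L'] [IsScalarTower K L L']`), `χ_N(θ σ') = χ_N(σ')` — the cyclotomic characters commute with
  the restriction `θ : G(L'|K') → G(L|K)`; `nonempty_algHom_of_isCyclotomicExtension`: such an inclusion exists.
* §2 **`cycloChar_abRestrict_ideleArtinMap_eq_cycloChar_ideleRelNorm`**:
  `χ_N([y, K']|_{L'}) = χ_N([N_{K'/K} y, K]|_L)` (no embedding in the statement);
  **`abRestrict_ideleArtinMap_apply_eq_pow_cycloChar_ideleRelNorm`**: `[y, K'] ζ = ζ^{χ_N([N_{K'/K} y, K]|_L)}`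
  for every `ζ ∈ L'` with `ζ^N = 1`;
  `cycloChar_abRestrict_ideleArtinMap_eq_artinHom_ideleIdeal_ideleRelNorm`: if `N_{K'/K} y ≡ 1 mod^× N`
  (`∈ I_K^{((N))}`), `χ_N([y, K']|_{L'}) = ∏_𝔭 χ_N(Frob^L_𝔭)^{ord_𝔭(N_{K'/K} y)}` (with the lane's
  `IdelicArtinMapOnCongruenceIdeles`).

## References

* J. Tate, *Global class field theory*, Ch. VII in J. W. S. Cassels, A. Fröhlich (eds.), *Algebraic Number
  Theory*, Academic Press 1967, §4 Prop. 4.3 (PDF p. 212), §5.7 (PDF p. 214). [CasselsFrohlichANT1967]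
* J. Neukirch, *Algebraic Number Theory*, Springer 1999, Ch. VI §5 Prop. (5.2) (p. 388), §6 Prop. (6.7)
  (p. 399). [NeukirchANT1999]
* G. Shimura, *Introduction to the Arithmetic Theory of Automorphic Functions*, Princeton 1971, §5.2
  (pp. 115–117), §6.8. [Shimura1971]

## Provenance

Lane `hodge-director` Track 2f (`flt-inv`), seat `literature-prover-hodge-director-flt-inv-g34-0` (FILE 2 of the seat).
-/

set_option autoImplicit false

noncomputable section

open scoped NumberField Polynomial
open NumberField IsDedekindDomain IsDedekindDomain.HeightOneSpectrum Field

namespace Literature.NumberTheory.NumberFields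

open Literature.NumberTheory.GaloisRepresentations
open Literature.NumberTheory.AdelicBaseChange

section General

variable {K K' : Type} [Field K] [NumberField K] [Field K'] [NumberField K'] [Algebra K K']
variable (N : ℕ) [NeZero N]
variable (L : IntermediateField K (AlgebraicClosure K)) [IsCyclotomicExtension {N} K L] [FiniteDimensional K L]
  [IsAbelianGalois K L] [NumberField L]
variable (L' : IntermediateField K' (AlgebraicClosure K')) [IsCyclotomicExtension {N} K' L']
  [FiniteDimensional K' L'] [IsAbelianGalois K' L'] [NumberField L']

/-- **`σ ζ = ζ^{χ_N(σ)}` for EVERY `N`-th root of unity `ζ`** of a cyclotomic extension of level `N` (not only the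
distinguished primitive one: `ζ = ζ_N^i`). [folklore] -/
private theorem algEquiv_apply_eq_pow_cycloChar {F : Type*} [Field F] {E : Type*} [Field E] [Algebra F E]
    [IsCyclotomicExtension {N} F E] (σ : E ≃ₐ[F] E) {ζ : E} (hζ : ζ ^ N = 1) :
    σ ζ = ζ ^ ((cycloChar F E N σ : (ZMod N)ˣ) : ZMod N).val := by
  obtain ⟨i, -, rfl⟩ := (IsCyclotomicExtension.zeta_spec N F E).eq_pow_of_pow_eq_one hζ
  rw [map_pow, cycloChar_spec, ← pow_mul, ← pow_mul, mul_comm]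

/-! ### §1. The cyclotomic characters commute with the restriction `θ : G(L'|K') → G(L|K)` -/

section WithAlgebra

variable [Algebra L L'] [IsScalarTower K L L']

omit [NumberField K] [NumberField K'] [NeZero N] [IsCyclotomicExtension {N} K L] [FiniteDimensional K L]
  [IsAbelianGalois K L] [NumberField L] [IsCyclotomicExtension {N} K' L'] [FiniteDimensional K' L']
  [IsAbelianGalois K' L'] [NumberField L'] in
/-- `θ(σ') = σ'|_L` commutes with the inclusion `L → L'`. [folklore] -/
private theorem algebraMap_restrictNormalHom_restrictScalars' [Normal K L] (σ' : L' ≃ₐ[K'] L') (x : L) :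
    algebraMap L L' (AlgEquiv.restrictNormalHom L (σ'.restrictScalars K) x) = σ' (algebraMap L L' x) := by
  rw [show AlgEquiv.restrictNormalHom L (σ'.restrictScalars K) = (σ'.restrictScalars K).restrictNormal L
      from rfl, AlgEquiv.restrictNormal_commutes (σ'.restrictScalars K) L x]
  rfl

omit [NumberField K] [NumberField K'] [FiniteDimensional K L] [NumberField L] [FiniteDimensional K' L']
  [IsAbelianGalois K' L'] [NumberField L'] in
/-- **The cyclotomic characters are compatible with restriction**: for `σ' ∈ G(K'(μ_N)|K')`,
`χ_N(σ'|_{K(μ_N)}) = χ_N(σ')` — both exponents describe `σ'` on the primitive `N`-th root `ζ_N ∈ K(μ_N) ⊆ K'(μ_N)`.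
[cite: CasselsFrohlichANT1967, Ch. VII §5.7 (PDF p. 214)] [cite: NeukirchANT1999, Ch. VI §6 Prop. (6.7) p. 399] -/
theorem cycloChar_restrictNormalHom_restrictScalars (σ' : L' ≃ₐ[K'] L') :
    cycloChar K L N (AlgEquiv.restrictNormalHom L (σ'.restrictScalars K)) = cycloChar K' L' N σ' := by
  haveI : IsGalois K L := isGalois_of_isCyclotomicExtension K L N
  set ζ := IsCyclotomicExtension.zeta N K L with hζ
  have hprim : IsPrimitiveRoot ζ N := IsCyclotomicExtension.zeta_spec N K L
  have hprim' : IsPrimitiveRoot (algebraMap L L' ζ) N := hprim.map_of_injective (algebraMap L L').injective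
  have h1 : σ' (algebraMap L L' ζ) =
      algebraMap L L' ζ ^ ((cycloChar K L N (AlgEquiv.restrictNormalHom L (σ'.restrictScalars K)) : (ZMod N)ˣ) :
        ZMod N).val := by
    rw [← algebraMap_restrictNormalHom_restrictScalars' L L', cycloChar_spec K L N, map_pow]
  have h2 : σ' (algebraMap L L' ζ) = algebraMap L L' ζ ^ ((cycloChar K' L' N σ' : (ZMod N)ˣ) : ZMod N).val :=
    algEquiv_apply_eq_pow_cycloChar N σ' hprim'.pow_eq_one
  exact Units.ext (ZMod.val_injective N (hprim'.pow_inj (ZMod.val_lt _) (ZMod.val_lt _) (h1.symm.trans h2)))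

/-- **Tate 4.3 through the cyclotomic characters, for a given inclusion `K(μ_N) → K'(μ_N)`**:
`χ_N([y, K']|_{L'}) = χ_N([N_{K'/K} y, K]|_L)` for every idèle `y` of `K'`.
[cite: CasselsFrohlichANT1967, Ch. VII §4 Prop. 4.3 (PDF p. 212)] [cite: NeukirchANT1999, Ch. VI §5 Prop. (5.2) (p. 388)] -/
theorem cycloChar_abRestrict_ideleArtinMap_eq_of_isScalarTower (y : ideleGroup K') :
    cycloChar K' L' N (abRestrict L' (ideleArtinMap K' y)) =
      cycloChar K L N (abRestrict L (ideleArtinMap K (ideleRelNorm K K' y))) := by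
  rw [← restrictNormalHom_abRestrict_ideleArtinMap L L' y, cycloChar_restrictNormalHom_restrictScalars]

end WithAlgebra

omit [NumberField K] [NumberField K'] [FiniteDimensional K L] [IsAbelianGalois K L] [NumberField L]
  [FiniteDimensional K' L'] [IsAbelianGalois K' L'] [NumberField L'] in
include N in
/-- **`K(μ_N)` embeds into `K'(μ_N)` over `K ⊆ K'`**: a `K`-algebra homomorphism `L → L'` exists (`L` is a splitting
field of `X^N - 1` over `K`, which splits in `L'`; Mathlib `Polynomial.IsSplittingField.lift`). [folklore]
[cite: NeukirchANT1999, Ch. VI §6 Prop. (6.7) p. 399] -/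
theorem nonempty_algHom_of_isCyclotomicExtension : Nonempty (L →ₐ[K] L') := by
  have hsplit : ((Polynomial.X ^ N - 1 : K[X]).map (algebraMap K L')).Splits := by
    rw [Polynomial.map_sub, Polynomial.map_pow, Polynomial.map_X, Polynomial.map_one, ← Polynomial.C_1]
    exact Polynomial.X_pow_sub_one_splits (IsCyclotomicExtension.zeta_spec N K' L')
  haveI := IsCyclotomicExtension.isSplittingField_X_pow_sub_one N K L
  exact ⟨Polynomial.IsSplittingField.lift L (Polynomial.X ^ N - 1) hsplit⟩

/-! ### §2. `χ_N([y, K']|_{K'(μ_N)}) = χ_N([N_{K'/K} y, K]|_{K(μ_N)})`, free of any embedding -/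

/-- **Tate 4.3 on roots of unity: `χ_N([y, K']|_{K'(μ_N)}) = χ_N([N_{K'/K} y, K]|_{K(μ_N)})`** for every idèle `y`
of `K'` — `[y, K']` acts on the `N`-th roots of unity with the same exponent as `[N_{K'/K} y, K]` (any cyclotomic
`L ⊆ K̄`, `L' ⊆ K̄'` of level `N`; no embedding `L → L'` needs to be chosen, the cyclotomic characters being
canonical). [cite: CasselsFrohlichANT1967, Ch. VII §4 Prop. 4.3 (PDF p. 212) and §5.7 (PDF p. 214)]
[cite: NeukirchANT1999, Ch. VI §5 Prop. (5.2) (p. 388)] -/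
theorem cycloChar_abRestrict_ideleArtinMap_eq_cycloChar_ideleRelNorm (y : ideleGroup K') :
    cycloChar K' L' N (abRestrict L' (ideleArtinMap K' y)) =
      cycloChar K L N (abRestrict L (ideleArtinMap K (ideleRelNorm K K' y))) := by
  obtain ⟨ι⟩ := nonempty_algHom_of_isCyclotomicExtension N L L'
  letI : Algebra L L' := ι.toRingHom.toAlgebra
  haveI : IsScalarTower K L L' := IsScalarTower.of_algebraMap_eq fun x => (ι.commutes x).symm
  exact cycloChar_abRestrict_ideleArtinMap_eq_of_isScalarTower N L L' y

/-- **`[y, K'] ζ = ζ^{χ_N([N_{K'/K} y, K])}` for every `N`-th root of unity `ζ ∈ K'(μ_N)`**: the idèle `y` of `K'`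
acts on `μ_N` through the norm `N_{K'/K} y` and the reciprocity map of `K`.
[cite: CasselsFrohlichANT1967, Ch. VII §4 Prop. 4.3 (PDF p. 212) and §5.7 (PDF p. 214)]
[cite: NeukirchANT1999, Ch. VI §5 Prop. (5.2) (p. 388)] -/
theorem abRestrict_ideleArtinMap_apply_eq_pow_cycloChar_ideleRelNorm (y : ideleGroup K') {ζ : L'} (hζ : ζ ^ N = 1) :
    abRestrict L' (ideleArtinMap K' y) ζ =
      ζ ^ ((cycloChar K L N (abRestrict L (ideleArtinMap K (ideleRelNorm K K' y))) : (ZMod N)ˣ) : ZMod N).val := by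
  rw [algEquiv_apply_eq_pow_cycloChar N _ hζ, cycloChar_abRestrict_ideleArtinMap_eq_cycloChar_ideleRelNorm N L L' y]

/-- **`χ_N([y, K']|_{K'(μ_N)}) = ∏_𝔭 χ_N(Frob^{K(μ_N)}_𝔭)^{ord_𝔭(N_{K'/K} y)}` when `N_{K'/K} y ∈ I_K^{((N))}`**
(`≡ 1 mod^× N`): the Artin symbol of the IDEAL of the norm (the lane's `IdelicArtinMapOnCongruenceIdeles`:
Shimura 1971 §5.2 «`[u, K]` coincides with the Artin symbol `(F_𝔠/K / il(u))`»).
[cite: Shimura1971, §5.2 p. 116] [cite: CasselsFrohlichANT1967, Ch. VII §4 Prop. 4.3 (PDF p. 212)] -/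
theorem cycloChar_abRestrict_ideleArtinMap_eq_artinHom_ideleIdeal_ideleRelNorm {y : ideleGroup K'}
    (hy : ideleRelNorm K K' y ∈ congruenceIdeles (Ideal.span {(N : 𝓞 K)})) :
    cycloChar K' L' N (abRestrict L' (ideleArtinMap K' y)) =
      artinHom (fun v => cycloChar K L N (galFrob K L v)) (ideleIdeal (ideleRelNorm K K' y)) := by
  rw [cycloChar_abRestrict_ideleArtinMap_eq_cycloChar_ideleRelNorm N L L' y,
    cycloChar_abRestrict_ideleArtinMap_of_mem_congruenceIdeles N L hy]

/-- The same for an arbitrary idèle `y` of `K'` and `a ∈ Kˣ` with `(a)·N_{K'/K} y ∈ I_K^{((N))}`: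
`χ_N([y, K']|_{K'(μ_N)}) = ∏_𝔭 χ_N(Frob_𝔭)^{ord_𝔭((a) N_{K'/K} y)}`. [cite: Shimura1971, §5.2 p. 116]
[cite: CasselsFrohlichANT1967, Ch. VII §4 Prop. 4.3 (PDF p. 212)] -/
theorem cycloChar_abRestrict_ideleArtinMap_eq_artinHom_ideleIdeal_mul_ideleRelNorm {y : ideleGroup K'} {a : Kˣ}
    (ha : principalIdele K a * ideleRelNorm K K' y ∈ congruenceIdeles (Ideal.span {(N : 𝓞 K)})) :
    cycloChar K' L' N (abRestrict L' (ideleArtinMap K' y)) =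
      artinHom (fun v => cycloChar K L N (galFrob K L v)) (ideleIdeal (principalIdele K a * ideleRelNorm K K' y)) := by
  rw [cycloChar_abRestrict_ideleArtinMap_eq_cycloChar_ideleRelNorm N L L' y,
    cycloChar_abRestrict_ideleArtinMap_eq_artinHom_ideleIdeal N L ha]

end General

end Literature.NumberTheory.NumberFields
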